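import Summits.QuantumFields.YangMills.Theorems.BalabanUVNodesPortZDTransportLocality
import Summits.QuantumFields.YangMills.Theorems.BalabanUVNodesPortZDStepRowsOn

/-!
# NODE O port, row PT-A′ helper lane (PTZ-1, gen 2): (1.19) ∕ (2.16) ON THE DOMAIN OVER THE CANONICAL TRANSPORT OF RECORD — the transform of a density
# lift-invariant over an open gauge-stable set `D` of coarse fields is gauge invariant at every point of `D ∩ regSet`; hence `𝓝⁰_{k+1}(W^v) = 𝓝⁰_{k+1}(W)`
# there for any cut-off family lift-invariant over `D` (the shape the re-centred (2.9) cut-off has on the [B11] domain)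

[Balaban1987RG1] = [I] (CMP 109, 1987): (0.13) p. 254 («ρ is a gauge invariant function … T(ρ) is gauge invariant»), p. 263 («the action A_k(U) defined on the space
U_k(ε₀) … is gauge invariant»), (2.16) p. 269, (2.9) p. 266; [Balaban1985Averaging] (11)–(13) p. 19.

Seat `ymgap-nodeO-port-PTZ-1` g2 (prover, HELPER MODE; `--supports stmt-QuantumFields-27930 --as helper`).  GENERIC (χ, ε, D BOUND; the transport is the tree's
canonical transport of record `TcanOfRecord = TβOfRecord₁₃`).  Companion of gen 0's `…PortZDStepRowsOn` (✓p798857: the on-domain (1.19) rows with the IMAGE clause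
`hTon` DISPLAYED) and of gen 2's `…PortZDTransportLocality` (✓p801932: locality over the base, pointwise on `regSet`); K0e's `Node00/CanonicalTransportOfRecord` §5
(`TcanOfRecord_gaugeAct_of_mem_regSet`: gauge invariance ON `regSet` for a GLOBALLY lift-invariant integrable density).

WHY.  The re-centred (2.9) cut-off of record `chiFixed29Ax` is lift-invariant ONLY ON THE [B11] DOMAIN (`Node00.chiFixed29Ax_gaugeAct_liftTransf`: solvability at
`V̄`, one minimal orbit at `V̄^v`) — never globally (junk branch) — so K0e's §5 does not apply to the record's densities as it stands.  THIS FILE supplies the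
ON-DOMAIN version by a truncation trick through gen 2's locality theorem: the density `ρ·𝟙_{avg⁻¹ D}` IS globally lift-invariant (averaging covariance + gauge-stability
of `D`), agrees with `ρ` over `D`, so the canonical transports of the two agree pointwise on `D ∩ regSet` and §5 transfers.
* §1 ★★ `TcanOfRecord_gaugeAct_of_liftInvariantOn` — `k < K`, `ρ` integrable, `D` open and gauge-stable, `ρ(V^{ṽ}) = ρ(V)` whenever `V̄ ∈ D` ⟹ for every coarse `v`
  and every `W ∈ D ∩ regSetOfRecord ρ`: `TcanOfRecord ρ (W^v) = TcanOfRecord ρ W` and `W^v ∈ D ∩ regSetOfRecord ρ`; `nextAction_TcanOfRecord_gaugeAct_on` — one step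
  of (0.19) on `D ∩ regSet` (= gen 0's displayed `hTon` DISCHARGED over the canonical transport from lift-invariance over `D`).
* §2 ★★ `zeroInputMergedTermT_gaugeAct_on_Tcan` — `𝓝⁰_{k+1}(W^v) = 𝓝⁰_{k+1}(W)` for `W ∈ D ∩ regSet(χ_k e^{−GF∕g_k² + A⁰_k})`, any cut-off family lift-invariant over
  `D`, integrable zero-input density, the [B11] clauses at `W` ∕ `W^v` displayed (gen 0's `zeroInputMergedTermT_gaugeAct_on` with its image clause supplied by §1;
  `A⁰_k` and `GF_k` invariant globally: `PortZD.gaugeInvariant_mainTermT`, `gfOfRecord_liftInvariant`).  The record instance (χ := `chiβOfRecord₁₃Ax θfill` on the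
  [15] Thm 1 domain) is the companion `…PortZDRecordGaugeOn`.
HONEST FRAMING.  Soft bookkeeping (indicator truncation, locality, K0e's measure-preserving-homeomorphism calculus); NOTHING of Bałaban's estimates asserted, ported
or discharged; integrability and `regSet`-membership are DISPLAYED; 26648 ∕ 27930⁸ SIGNED·OPEN (content-gated), 27931 under CLOSE HOLD, 27932 CLOSED; counts unmoved;
finite 𝕋⁴ at fixed ε — NOT continuum ∕ OS ∕ Clay; the Yang–Mills mass gap is NOT proved by any of this.  No `sorry` ∕ `def` ∕ `instance` ∕ `notation`.
-/

noncomputable section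

open MeasureTheory Set Filter
open scoped Topology

namespace Summit.QuantumFields.YangMills.Theorems.PortZD

open Literature.MathematicalPhysics.QuantumFieldTheory.Balaban1983to89
open Literature.MathematicalPhysics.QuantumFieldTheory.Balaban1983to89.Node00
open Literature.MathematicalPhysics.QuantumFieldTheory.Balaban1983to89.T4Continuum (T4Family)
open B12Eq019ActionBody (nextAction nextAction_apply normConst normConst_def integrand integrand_apply)
open B12RTGaugeInvariance254 (LiftInvariant liftTransf avg_gaugeAct_liftTransf invTransf gaugeAct_inv_gaugeAct gaugeAct_gaugeAct_inv)
open B12EffectiveActionInvarianceT (gfOfRecord_liftInvariant)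
open GaugeField (gaugeAct)

variable {F : T4Family} {N : ℕ} [NeZero N]

/-! ## §1. Gauge invariance of the canonical transport on `D ∩ regSet` from lift-invariance over `D` -/

/-- ★★ **THE CANONICAL TRANSPORT OF A DENSITY LIFT-INVARIANT OVER AN OPEN GAUGE-STABLE SET `D` IS GAUGE INVARIANT AT EVERY POINT OF `D ∩ regSet`** (and `D ∩ regSet`
is gauge-stable): `k < K`, `ρ` integrable, `ρ(V^{ṽ}) = ρ(V)` whenever `V̄ ∈ D`.  Truncation `ρ·𝟙_{avg⁻¹ D}` is globally lift-invariant (`avg_gaugeAct_liftTransf` + stability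
of `D`) and agrees with `ρ` over `D`; gen 2's `TcanOfRecord_eqOn_of_eqOn_preimage` (both directions) and K0e's `TcanOfRecord_gaugeAct_of_mem_regSet` ∕
`gaugeAct_mem_regSetOfRecord_iff` for the truncation. [cite: Balaban1987RG1, (0.13) p.254 and p.263; Balaban1985Averaging, (11)–(13) p.19] -/
theorem TcanOfRecord_gaugeAct_of_liftInvariantOn {K k : ℕ} (hk : k < K) {ρ : Density (F.P K) k (SU N)}
    (hρ : Integrable ρ (fieldMeasure (F.P K) k (SU N))) {D : Set (PBond (F.P K) (k + 1) → SU N)} (hDo : IsOpen D)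
    (hDst : ∀ (v : GaugeTransf (F.P K) (k + 1) (SU N)) (V : GaugeField (F.P K) (k + 1) (SU N)), V ∈ D → gaugeAct v V ∈ D)
    (hlift : ∀ (v : GaugeTransf (F.P K) (k + 1) (SU N)) (V : GaugeField (F.P K) k (SU N)), (avOfRecord F N K k).avg V ∈ D →
      ρ (gaugeAct (liftTransf v) V) = ρ V)
    (v : GaugeTransf (F.P K) (k + 1) (SU N)) {W : GaugeField (F.P K) (k + 1) (SU N)} (hW : W ∈ D ∩ regSetOfRecord F N K k ρ) :
    TcanOfRecord F N K k ρ (gaugeAct v W) = TcanOfRecord F N K k ρ W ∧ gaugeAct v W ∈ D ∩ regSetOfRecord F N K k ρ := by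
  classical
  have hj : k + 1 ≤ (F.P K).m + (F.P K).K := by simp only [T4Continuum.T4Family.P_K]; omega
  have havg := avOfRecord_measurable F N K k
  -- stability of `D` under inverses
  have hDst' : ∀ (v : GaugeTransf (F.P K) (k + 1) (SU N)) (V : GaugeField (F.P K) (k + 1) (SU N)), gaugeAct v V ∈ D → V ∈ D := by
    intro v V hV
    have h := hDst (invTransf v) _ hV
    rwa [gaugeAct_inv_gaugeAct] at h
  -- the truncated density
  set ρ' : Density (F.P K) k (SU N) := Set.indicator ((avOfRecord F N K k).avg ⁻¹' D) ρ with hρ'def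
  have hmeas : MeasurableSet ((avOfRecord F N K k).avg ⁻¹' D) := havg hDo.measurableSet
  have hρ' : Integrable ρ' (fieldMeasure (F.P K) k (SU N)) := hρ.indicator hmeas
  have hagree : ∀ V : GaugeField (F.P K) k (SU N), (avOfRecord F N K k).avg V ∈ D → ρ V = ρ' V := fun V hV => by
    rw [hρ'def, Set.indicator_of_mem (show V ∈ (avOfRecord F N K k).avg ⁻¹' D from hV)]
  have hlift' : LiftInvariant ρ' := by
    intro u V
    by_cases hV : (avOfRecord F N K k).avg V ∈ D
    · have hV' : gaugeAct (liftTransf u) V ∈ (avOfRecord F N K k).avg ⁻¹' D := by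
        show (avOfRecord F N K k).avg (gaugeAct (liftTransf u) V) ∈ D
        rw [avg_gaugeAct_liftTransf hj]
        exact hDst u _ hV
      rw [hρ'def, Set.indicator_of_mem hV', Set.indicator_of_mem (show V ∈ (avOfRecord F N K k).avg ⁻¹' D from hV), hlift u V hV]
    · have hV' : gaugeAct (liftTransf u) V ∉ (avOfRecord F N K k).avg ⁻¹' D := by
        intro h
        apply hV
        have h' : (avOfRecord F N K k).avg (gaugeAct (liftTransf u) V) ∈ D := h
        rw [avg_gaugeAct_liftTransf hj] at h'
        exact hDst' u _ h'
      rw [hρ'def, Set.indicator_of_notMem hV', Set.indicator_of_notMem (show V ∉ (avOfRecord F N K k).avg ⁻¹' D from hV)]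
  obtain ⟨hEq, hsub⟩ := TcanOfRecord_eqOn_of_eqOn_preimage hk hDo hagree
  obtain ⟨hEq', hsub'⟩ := TcanOfRecord_eqOn_of_eqOn_preimage hk hDo fun V hV => (hagree V hV).symm
  -- hEq : EqOn (Tcan ρ') (Tcan ρ) (D ∩ regSet ρ), hsub : D ∩ regSet ρ ⊆ regSet ρ'
  -- hEq' : EqOn (Tcan ρ) (Tcan ρ') (D ∩ regSet ρ'), hsub' : D ∩ regSet ρ' ⊆ regSet ρ
  have hWρ' : (W : PBond (F.P K) (k + 1) → SU N) ∈ regSetOfRecord F N K k ρ' := hsub hW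
  have hvWρ' : gaugeAct v W ∈ regSetOfRecord F N K k ρ' := (gaugeAct_mem_regSetOfRecord_iff hk hρ' hlift' v W).2 hWρ'
  have hvWD : gaugeAct v W ∈ D := hDst v W hW.1
  have hvWρ : gaugeAct v W ∈ regSetOfRecord F N K k ρ := hsub' ⟨hvWD, hvWρ'⟩
  refine ⟨?_, hvWD, hvWρ⟩
  calc TcanOfRecord F N K k ρ (gaugeAct v W) = TcanOfRecord F N K k ρ' (gaugeAct v W) := hEq' ⟨hvWD, hvWρ'⟩
    _ = TcanOfRecord F N K k ρ' W := TcanOfRecord_gaugeAct_of_mem_regSet hk hρ' hlift' v hWρ'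
    _ = TcanOfRecord F N K k ρ W := hEq hW

/-- **ONE STEP OF (0.19) ON `D ∩ regSet` OVER THE CANONICAL TRANSPORT**: `𝐓_k(A)(W^v) = 𝐓_k(A)(W)` for `W ∈ D ∩ regSet(χ_k e^{−GF∕g_k² + A})` whenever that density is
integrable and lift-invariant over the open gauge-stable `D` — gen 0's displayed image clause `hTon` DISCHARGED there (`𝐍_k` does not see `W`).
[cite: Balaban1987RG1, (0.19) p.255 and p.263] -/
theorem nextAction_TcanOfRecord_gaugeAct_on {K k : ℕ} (hk : k < K) {χ GF A : Density (F.P K) k (SU N)} {gk : ℝ}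
    (hρ : Integrable (integrand χ GF gk A) (fieldMeasure (F.P K) k (SU N))) {D : Set (PBond (F.P K) (k + 1) → SU N)} (hDo : IsOpen D)
    (hDst : ∀ (v : GaugeTransf (F.P K) (k + 1) (SU N)) (V : GaugeField (F.P K) (k + 1) (SU N)), V ∈ D → gaugeAct v V ∈ D)
    (hlift : ∀ (v : GaugeTransf (F.P K) (k + 1) (SU N)) (V : GaugeField (F.P K) k (SU N)), (avOfRecord F N K k).avg V ∈ D →
      integrand χ GF gk A (gaugeAct (liftTransf v) V) = integrand χ GF gk A V)
    (v : GaugeTransf (F.P K) (k + 1) (SU N)) {W : GaugeField (F.P K) (k + 1) (SU N)}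
    (hW : W ∈ D ∩ regSetOfRecord F N K k (integrand χ GF gk A)) :
    nextAction (TcanOfRecord F N K k) χ GF gk A (gaugeAct v W) = nextAction (TcanOfRecord F N K k) χ GF gk A W := by
  rw [nextAction_apply, nextAction_apply, (TcanOfRecord_gaugeAct_of_liftInvariantOn hk hρ hDo hDst hlift v hW).1]

/-! ## §2. `𝓝⁰_{k+1}` on `D ∩ regSet` over the canonical transport, any cut-off family lift-invariant over `D` -/

/-- The zero-input (0.19) density `χ_k e^{−GF_k∕g_k² + A⁰_k}` is lift-invariant over `D` as soon as `χ_k` is: `GF_k` is lift-invariant (`gfOfRecord_liftInvariant`) and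
`A⁰_k` gauge invariant (`PortZD.gaugeInvariant_mainTermT`) globally. [cite: Balaban1987RG1, (0.17) p.255, p.263 L31–33] -/
theorem integrand_mainTermT_liftInvariantOn (χ : (K : ℕ) → (ℕ → ℝ) → (k : ℕ) → Density (F.P K) k (SU N)) (ε : ℝ) {K : ℕ} (g : ℕ → ℝ)
    {k : ℕ} (hk : k + 1 ≤ (F.P K).m + (F.P K).K) {D : Set (PBond (F.P K) (k + 1) → SU N)}
    (hχ : ∀ (v : GaugeTransf (F.P K) (k + 1) (SU N)) (V : GaugeField (F.P K) k (SU N)), (avOfRecord F N K k).avg V ∈ D →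
      χ K g k (gaugeAct (liftTransf v) V) = χ K g k V)
    (v : GaugeTransf (F.P K) (k + 1) (SU N)) (V : GaugeField (F.P K) k (SU N)) (hV : (avOfRecord F N K k).avg V ∈ D) :
    integrand (χ K g k) (gfOfRecord F N K k) (g k) (ZeroInput.mainTermT F N ε K g k) (gaugeAct (liftTransf v) V) =
      integrand (χ K g k) (gfOfRecord F N K k) (g k) (ZeroInput.mainTermT F N ε K g k) V := by
  rw [integrand_apply, integrand_apply, hχ v V hV, gfOfRecord_liftInvariant F N K hk v V,
    gaugeInvariant_mainTermT F N ε g (Nat.le_of_succ_le hk) (liftTransf v) V]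

/-- ★★ **THE (1.19) ROW OF (Z) ON THE DOMAIN, OVER THE CANONICAL TRANSPORT, IMAGE CLAUSE DISCHARGED**: `𝓝⁰_{k+1}(W^v) = 𝓝⁰_{k+1}(W)` for every coarse `v` and every
`W ∈ D ∩ regSet(χ_k e^{−GF_k∕g_k² + A⁰_k})`, `D` open and gauge-stable, the cut-off `χ_k` lift-invariant over `D` (the shape `Node00.chiFixed29Ax_gaugeAct_liftTransf` delivers
on the [B11] domain), the zero-input density integrable, `k < K`, and the [B11] clauses `UkExists (k+1) ε W`, `UniqueUkOrbit (k+1) ε (W^v)` displayed.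
[cite: Balaban1987RG1, (1.19) p.263, (2.16) p.269, (0.13) p.254; Balaban1985Variational, (181) p.307] -/
theorem zeroInputMergedTermT_gaugeAct_on_Tcan (χ : (K : ℕ) → (ℕ → ℝ) → (k : ℕ) → Density (F.P K) k (SU N)) (ε : ℝ) {K : ℕ}
    (g : ℕ → ℝ) {k : ℕ} (hk : k < K) {D : Set (PBond (F.P K) (k + 1) → SU N)} (hDo : IsOpen D)
    (hDst : ∀ (v : GaugeTransf (F.P K) (k + 1) (SU N)) (V : GaugeField (F.P K) (k + 1) (SU N)), V ∈ D → gaugeAct v V ∈ D)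
    (hχ : ∀ (v : GaugeTransf (F.P K) (k + 1) (SU N)) (V : GaugeField (F.P K) k (SU N)), (avOfRecord F N K k).avg V ∈ D →
      χ K g k (gaugeAct (liftTransf v) V) = χ K g k V)
    (hρ : Integrable (integrand (χ K g k) (gfOfRecord F N K k) (g k) (ZeroInput.mainTermT F N ε K g k)) (fieldMeasure (F.P K) k (SU N)))
    (v : GaugeTransf (F.P K) (k + 1) (SU N)) {W : GaugeField (F.P K) (k + 1) (SU N)}
    (hWD : W ∈ D ∩ regSetOfRecord F N K k (integrand (χ K g k) (gfOfRecord F N K k) (g k) (ZeroInput.mainTermT F N ε K g k)))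
    (hW : UkExists F N K (k + 1) ε W) (hu : UniqueUkOrbit F N K (k + 1) ε (gaugeAct v W)) :
    ZeroInput.zeroInputMergedTermT F N (TcanOfRecord F N) χ ε K g k (gaugeAct v W) =
      ZeroInput.zeroInputMergedTermT F N (TcanOfRecord F N) χ ε K g k W := by
  have hk' : k + 1 ≤ (F.P K).m + (F.P K).K := by simp only [T4Continuum.T4Family.P_K]; omega
  have hDst2 : ∀ (v : GaugeTransf (F.P K) (k + 1) (SU N)) (V : GaugeField (F.P K) (k + 1) (SU N)),
      V ∈ D ∩ regSetOfRecord F N K k (integrand (χ K g k) (gfOfRecord F N K k) (g k) (ZeroInput.mainTermT F N ε K g k)) →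
        TcanOfRecord F N K k (integrand (χ K g k) (gfOfRecord F N K k) (g k) (ZeroInput.mainTermT F N ε K g k)) (gaugeAct v V) =
          TcanOfRecord F N K k (integrand (χ K g k) (gfOfRecord F N K k) (g k) (ZeroInput.mainTermT F N ε K g k)) V :=
    fun v V hV => (TcanOfRecord_gaugeAct_of_liftInvariantOn hk hρ hDo hDst (integrand_mainTermT_liftInvariantOn χ ε g hk' hχ) v hV).1
  exact zeroInputMergedTermT_gaugeAct_on F N (TcanOfRecord F N) χ ε g hk' hDst2 v hWD hW hu

end Summit.QuantumFields.YangMills.Theorems.PortZD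

end
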